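import Summits.HodgeConjecture.HodgeConjecture.Theorems.Ring2WeilCoverageCyclotomicTwistedLevel39
import Summits.HodgeConjecture.HodgeConjecture.Theorems.Ring2WeilCoverageCyclotomicUnconditional
import HarnessLib

/-!
# Weil-type family coverage — the census level `M = 56` in the kernel: `√2 = ζ₈ + ζ₈⁻¹` and `√7 ∈ ℚ(ζ₂₈)⁺` in
# `ℚ(ζ₅₆)⁺`, the twisted NO verdict on both classes of `χ₈`, and the rows «(56, ℚ(i)) / (56, ℚ(√−2)): NO when
# `n₊₋(Φ)` is EVEN», «(56, ℚ(√−7)) / (56, ℚ(√−14)): NO when `n₊₋(Φ)` is ODD» — hypothesis-free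

research route conditional on HC_CM; not a corollary; Q11.4-sentence-2 already refuted in dim ≥ 3.

Ring 2, WEIL-TYPE FAMILY-COVERAGE CENSUS (`HOME/WEIL-FAMILY-COVERAGE.md` `## b01`, block b01.25 (A): «`M = 56`:
`K = ℚ(i), ℚ(√−2)`: `A_Φ` principal ⟺ `n₊₋(Φ)` ODD; `K = ℚ(√−7), ℚ(√−14)`: ⟺ EVEN (`χ′ = χ₈`); every unit of
`ℚ(ζ₅₆)⁺` has totally positive relative norm to `ℚ(√2)` (PARI)»; owner ring2-b01), part 37 of the
`Ring2WeilCoverage*` series — the second index-2 level, as part 36 did `39`: parts 26b (dictionary for `√2` at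
`8 ∣ n`), 35 (twisted engine), 34b (relative-norm positivity at `(2, 7)`, i.e. for fields containing `ℚ(√2, √7)`), 9
(`√7 ∈ ℚ(ζ₂₈)⁺`).

* §1 `sq_sqrtTwo` / `complexConj_sqrtTwo`: `s = μ + μ⁷` (`μ = ζ⁷` a primitive 8th root) has `s² = 2` and is real;
  `w = √7` is part 9's `(ζ²)⁷(1 + 2((ζ²)⁴ + (ζ²)⁸ + (ζ²)¹⁶))`.
* §2 **`not_exists_principal_fiftySix_of_odd_on`**: for `K ⊇ ℚ(ζ₅₆)` cyclotomic CM, ANY CM type `Φ` and either class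
  `b` of `χ₈`: if `#{t ∈ S_Φ ∩ N_odd : (χ₈(t) = −1 ↔ b)}` is ODD then `ℂ^Φ/Φ(ℤ[ζ₅₆])` carries NO `ι`-compatible
  principal polarisation — NO HYPOTHESIS.
* §3 the rows: `nodd_fiftySix_eq`; **`not_exists_principal_fiftySix_plus` / `_minus`** (`C₊ = {χ₈ = +1} =
  {1,9,15,17,23,25,31,33,39,41,47,55}`, `C₋ = {3,5,11,13,19,27,29,37,43,45,51,53}`); **`…_of_even`**:
  `|S_Φ ∩ {15,23,31,39,47,55}|` EVEN ⇒ NO (`= C₊ ∩ N_K` for `K = ℚ(i)` AND `K = ℚ(√−2)`: `n₊₋(Φ)` even ⇒ NO);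
  **`…_of_odd`**: `|S_Φ ∩ {17,31,33,41,47,55}|` ODD ⇒ NO (`= C₊ ∩ N_K` for `K = ℚ(√−7)` AND `K = ℚ(√−14)`: `n₊₋(Φ)`
  odd ⇒ NO) — census b01.25 (A)'s NO classes at `56` (452 resp. 472 of the 924 `K`-balanced types per `K`), now
  hypothesis-free kernel theorems for the lattice `ℤ[ζ₅₆]`.

NOTE (correcting b01.38 (E)'s route note): the device at `56` is the biquadratic step `ℚ(√2, √7)/ℚ(√2)`, ramified at
both primes above `7 = (3 + √2)(3 − √2)` — not a cyclic quartic field of conductor `56` (there is none containing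
`ℚ(√2)`).  HONEST FRAMING: statements about Shimura's divisors of principal type on `ℂ^Φ/Φ(ℤ[ζ₅₆])` (principal
lattice only; `h(ℚ(ζ₅₆)) = 2`); the YES direction is NOT proved here; nothing here is a statement about Hodge
classes, `W_K`, general members or HC; `HC_CM` is used nowhere.  No `def`, no named fact, no `sorry`.

References: [cite: Shimura1998, §14.3 Prop. 4–5, pp. 103–104]; census b01.25 (A) (seat-derived).
-/

noncomputable section

open Polynomial NumberField Complex Finset
open scoped nonZeroDivisors Real

namespace Summit.HodgeConjecture.Ring2WeilCoverage.CyclotomicTwistedLevel56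

open Literature.AlgebraicGeometry.Motives (CMType)
open Literature.AlgebraicGeometry.HodgeTheory (IsCMTypeSet)
open Literature.AlgebraicGeometry.ComplexMultiplication.CyclotomicCMType
open Literature.NumberTheory.ComplexMultiplication
open Summit.HodgeConjecture.Ring2WeilCoverage.CyclotomicTwistedObstruction
open Summit.HodgeConjecture.Ring2WeilCoverage.CyclotomicTwistedLevel39 (odd_card_filter_inter_of)
open Summit.HodgeConjecture.Ring2WeilCoverage.RelativeNormPositivityLevels
open Summit.HodgeConjecture.Ring2WeilCoverage.ResidueDictionaryPiecesB (re_embedding_sqrtTwo_neg_iff)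
open Summit.HodgeConjecture.Ring2WeilCoverage.CyclotomicUnconditional (sq_sqrtSeven complexConj_sqrtSeven)
open Summit.HodgeConjecture.Ring2WeilCoverage.RealQuadraticUnitNorm (complexConj_eq_inv_of_pow_eq_one)

/-! ### §1 `√2 = ζ₈ + ζ₈⁻¹ ∈ ℚ(ζ₅₆)⁺` -/

section Elements

variable {K : Type} [Field K]

/-- **`(μ + μ⁷)² = 2`** for a primitive 8th root of unity `μ` (`μ⁴ = −1`, so `μ² + μ⁶ = 0`).
research route conditional on HC_CM; not a corollary; Q11.4-sentence-2 already refuted in dim ≥ 3. [folklore] -/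
theorem sq_sqrtTwo {μ : K} (hμ : IsPrimitiveRoot μ 8) : (μ + μ ^ 7) ^ 2 = (2 : K) := by
  have h8 : μ ^ 8 = 1 := hμ.pow_eq_one
  have h4 : μ ^ 4 = -1 := by
    have := hμ.pow (by norm_num : 0 < 8) (show 8 = 4 * 2 by norm_num)
    exact this.eq_neg_one_of_two_right
  linear_combination μ ^ 2 * h4 + (2 + μ ^ 6) * h8

variable [NumberField K] [IsCMField K]

/-- **`μ + μ⁷` is real** (conjugation inverts `μ`: `μ ↦ μ⁷`).
research route conditional on HC_CM; not a corollary; Q11.4-sentence-2 already refuted in dim ≥ 3. [folklore] -/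
theorem complexConj_sqrtTwo {μ : K} (hμ : IsPrimitiveRoot μ 8) :
    IsCMField.complexConj K (μ + μ ^ 7) = μ + μ ^ 7 := by
  have h8 : μ ^ 8 = 1 := hμ.pow_eq_one
  have hc : IsCMField.complexConj K μ = μ ^ 7 := by
    rw [complexConj_eq_inv_of_pow_eq_one (by norm_num) h8]
    exact inv_eq_of_mul_eq_one_right (by linear_combination h8)
  simp only [map_add, map_pow, hc]
  linear_combination (μ * (μ ^ 40 + μ ^ 32 + μ ^ 24 + μ ^ 16 + μ ^ 8 + 1)) * h8

end Elements

/-! ### §2 The twisted NO verdict at `M = 56`, hypothesis-free -/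

section Level56

variable {K : Type} [Field K] [NumberField K] [IsCMField K] [IsCyclotomicExtension {56} ℚ K] {ζ : K}

/-- `𝐞(t) = exp(2πi t/56) ∈ ℂ` (`ZMod.toCircle`). -/
local notation3 (prettyPrint := false) "𝐞 " t:max => ((ZMod.toCircle t : Circle) : ℂ)

/-- The census's set `N_odd` at `56` (unit residues at odd positions), as a filter. -/
local notation3 (prettyPrint := false) "Nodd" =>
  (Finset.univ.filter fun t : ZMod 56 => t.val.Coprime 56 ∧
    Even (Finset.card (Finset.filter (fun s : ZMod 56 => s.val.Coprime 56 ∧ s.val < t.val) Finset.univ)))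

/-- The dictionary predicate of part 26b for `√2`: «`t ≡ ±3 (mod 8)`» (`χ₈(t) = −1`). -/
local notation3 (prettyPrint := false) "NR8 " t:max =>
  (({1, 7} : Finset (ZMod 8)).image (· * (((ZMod.val t : ℕ) : ℕ) : ZMod 8)) = ({3, 5} : Finset (ZMod 8)))

open scoped Classical in
/-- **THE TWISTED NO VERDICT AT `M = 56` (no hypothesis).**  For any `K` with `IsCyclotomicExtension {56} ℚ K`,
`[IsCMField K]`, `ζ` a primitive 56th root of unity, any CM type `Φ` and either class `b` (`b = False`: `χ₈(t) = +1`;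
`b = True`: `χ₈(t) = −1`): if the number of `t ∈ S_Φ ∩ N_odd` with `(χ₈(t) = −1 ↔ b)` is ODD, then `ℂ^Φ/Φ(ℤ[ζ₅₆])`
carries NO `ι`-compatible principal polarisation.  Ingredients: `s = ζ⁷ + ζ⁴⁹ = √2`, `w = √7 ∈ ℚ(ζ₂₈)⁺` (part 9) in
`K⁺`; THEOREM L′ «`N_{K⁺/ℚ(√2)}(v) ≫ 0`» = part 34b; the dictionary `Re σ_t(√2) < 0 ↔ χ₈(t) = −1` = part 26b;
the engine = part 35.
research route conditional on HC_CM; not a corollary; Q11.4-sentence-2 already refuted in dim ≥ 3. [cite: Shimura1998, §14.3 Prop. 5, p. 104] -/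
theorem not_exists_principal_fiftySix_of_odd_on (hζ : IsPrimitiveRoot ζ 56) (Φ : CMType K) (b : Prop)
    [Decidable b]
    (hodd : Odd ((((Finset.univ.filter fun t : ZMod 56 => ∃ σ ∈ Φ.1, σ ζ = 𝐞 t).filter
      fun t => (NR8 t ↔ b)) ∩ Nodd).card)) :
    ¬ ∃ ζ' : K, IsCMField.complexConj K ζ' = -ζ' ∧ (∀ φ : Φ.1, 0 < (φ.1 ζ').im) ∧
        CMTypeLattice.IsOfType (1 : (FractionalIdeal (𝓞 K)⁰ K)ˣ) ζ' ⊤ := by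
  classical
  have hg : Nat.totient 56 = 2 * (11 + 1) := by decide
  have hμ : IsPrimitiveRoot (ζ ^ 7) 8 := hζ.pow (by norm_num) (by norm_num)
  have hζ2 : IsPrimitiveRoot (ζ ^ 2) 28 := hζ.pow (by norm_num) (by norm_num)
  -- the elements `s = √2`, `w = √7` of `K`
  set s₀ : K := ζ ^ (56 / 8) + ζ ^ (56 / 8 * 7) with hs₀
  have hs₀eq : s₀ = ζ ^ 7 + (ζ ^ 7) ^ 7 := by
    have h7 : (56 / 8 : ℕ) = 7 := by norm_num
    rw [hs₀, h7]; ring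
  set w₀ : K := (ζ ^ 2) ^ 7 * (1 + 2 * ((ζ ^ 2) ^ 4 + (ζ ^ 2) ^ 8 + (ζ ^ 2) ^ 16)) with hw₀
  have hsreal : IsCMField.complexConj K s₀ = s₀ := by rw [hs₀eq]; exact complexConj_sqrtTwo hμ
  have hwreal : IsCMField.complexConj K w₀ = w₀ := complexConj_sqrtSeven hζ2
  have hs2 : s₀ ^ 2 = 2 := by rw [hs₀eq]; exact sq_sqrtTwo hμ
  have hw2 : w₀ ^ 2 = 7 := sq_sqrtSeven hζ2
  -- in `K⁺`
  set s : maximalRealSubfield K := ⟨s₀, (IsCMField.complexConj_eq_self_iff K s₀).mp hsreal⟩ with hs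
  set w : maximalRealSubfield K := ⟨w₀, (IsCMField.complexConj_eq_self_iff K w₀).mp hwreal⟩ with hw
  have hs2' : s ^ 2 = 2 := by apply Subtype.ext; push_cast; exact hs2
  have hw2' : w ^ 2 = 7 := by apply Subtype.ext; push_cast; exact hw2
  have hsK : (s : K) = s₀ := rfl
  have hs2K : (s : K) ^ 2 = ((2 : ℕ) : K) := by rw [hsK, hs2]; norm_num
  -- THEOREM L′ at 56 (part 34b) and the dictionary (part 26b)
  have hN : ∀ v : (𝓞 (maximalRealSubfield K))ˣ, ∀ σ : maximalRealSubfield K →+* ℂ,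
      0 < (σ (algebraMap (IntermediateField.adjoin ℚ {s}) (maximalRealSubfield K)
        (Algebra.norm (IntermediateField.adjoin ℚ {s})
          (((v : 𝓞 (maximalRealSubfield K)) : maximalRealSubfield K))))).re :=
    fun v σ => re_embedding_relNorm_pos_two hs2' hw2' v σ
  have hdict : ∀ {φ : K →+* ℂ} {t : ZMod 56}, φ ζ = 𝐞 t → t.val.Coprime 56 →
      ((((φ (s : K)).re < 0 ↔ NR8 t) ∧ (φ (s : K)).re ≠ 0) ∧ (φ (s : K)).im = 0) :=
    fun hφ ht => re_embedding_sqrtTwo_neg_iff (n := 56) (by norm_num) hφ ht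
  exact not_exists_principal_of_relNorm_pos_of_odd_on hζ hg Φ s hs2K (fun t : ZMod 56 => NR8 t) hdict hN b
    hodd

/-! ### §3 The rows: `N_odd`, the classes `C_± = {χ₈ = ±1}`, `C₊ ∩ N_K` for the four `K` -/

/-- `N_odd` at `56` displayed: the unit residues at odd positions `u₁, u₃, …, u₂₃`. [folklore] -/
theorem nodd_fiftySix_eq : Nodd = ({1, 5, 11, 15, 19, 25, 29, 33, 39, 43, 47, 53} : Finset (ZMod 56)) := by
  decide

/-- The classes `C₊ = {χ₈(t) = +1} = {1,9,15,17,23,25,31,33,39,41,47,55}`, `C₋ = {3,5,11,13,19,27,29,37,43,45,51,53}`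
through the dictionary predicate, both stable under negation; the CM type sets `N_odd`, `N_{ℚ(i)} = {t ≡ 3 (4)}`,
`N_{ℚ(√−7)} = {t : (t/7) = −1}`; `C₊ ∩ N_{ℚ(i)} = {15,23,31,39,47,55}` with `|C₊ ∩ (N_odd ∖ N_{ℚ(i)})| = 3`;
`C₊ ∩ N_{ℚ(√−7)} = {17,31,33,41,47,55}` with `|C₊ ∩ (N_odd ∖ N_{ℚ(√−7)})| = 4` — all by `decide`. [folklore] -/
theorem classes_fiftySix :
    (∀ t : ZMod 56, t.val.Coprime 56 →
      (t ∈ ({1, 9, 15, 17, 23, 25, 31, 33, 39, 41, 47, 55} : Finset (ZMod 56)) ↔ (NR8 t ↔ False))) ∧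
    (∀ t : ZMod 56, t.val.Coprime 56 →
      (t ∈ ({3, 5, 11, 13, 19, 27, 29, 37, 43, 45, 51, 53} : Finset (ZMod 56)) ↔ (NR8 t ↔ True))) ∧
    (∀ t ∈ ({1, 9, 15, 17, 23, 25, 31, 33, 39, 41, 47, 55} : Finset (ZMod 56)),
      -t ∈ ({1, 9, 15, 17, 23, 25, 31, 33, 39, 41, 47, 55} : Finset (ZMod 56))) ∧
    IsCMTypeSet 56 ({1, 5, 11, 15, 19, 25, 29, 33, 39, 43, 47, 53} : Finset (ZMod 56)) ∧
    IsCMTypeSet 56 ({3, 11, 15, 19, 23, 27, 31, 39, 43, 47, 51, 55} : Finset (ZMod 56)) ∧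
    IsCMTypeSet 56 ({3, 5, 13, 17, 19, 27, 31, 33, 41, 45, 47, 55} : Finset (ZMod 56)) ∧
    ({1, 9, 15, 17, 23, 25, 31, 33, 39, 41, 47, 55} : Finset (ZMod 56)) ∩
        ({3, 11, 15, 19, 23, 27, 31, 39, 43, 47, 51, 55} : Finset (ZMod 56)) = {15, 23, 31, 39, 47, 55} ∧
    (({1, 9, 15, 17, 23, 25, 31, 33, 39, 41, 47, 55} : Finset (ZMod 56)) ∩
        (({1, 5, 11, 15, 19, 25, 29, 33, 39, 43, 47, 53} : Finset (ZMod 56)) \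
          ({3, 11, 15, 19, 23, 27, 31, 39, 43, 47, 51, 55} : Finset (ZMod 56)))).card = 3 ∧
    ({1, 9, 15, 17, 23, 25, 31, 33, 39, 41, 47, 55} : Finset (ZMod 56)) ∩
        ({3, 5, 13, 17, 19, 27, 31, 33, 41, 45, 47, 55} : Finset (ZMod 56)) = {17, 31, 33, 41, 47, 55} ∧
    (({1, 9, 15, 17, 23, 25, 31, 33, 39, 41, 47, 55} : Finset (ZMod 56)) ∩
        (({1, 5, 11, 15, 19, 25, 29, 33, 39, 43, 47, 53} : Finset (ZMod 56)) \
          ({3, 5, 13, 17, 19, 27, 31, 33, 41, 45, 47, 55} : Finset (ZMod 56)))).card = 4 := by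
  refine ⟨?_, ?_, by decide, by decide, by decide, by decide, by decide, by decide, by decide, by decide⟩
  · decide
  · decide

open scoped Classical in
/-- **Row `C₊` at `56`**: for any CM type `Φ`, `|S_Φ ∩ C₊ ∩ N_odd|` ODD (`C₊ = {χ₈(t) = +1}`,
`N_odd = {1,5,11,15,19,25,29,33,39,43,47,53}`) ⇒ NO `ι`-compatible principal polarisation on `ℂ^Φ/Φ(ℤ[ζ₅₆])` — the
functional `λ = Σ_{χ₈(t)=+1}` of census b01.25 (A) in the kernel.
research route conditional on HC_CM; not a corollary; Q11.4-sentence-2 already refuted in dim ≥ 3. [cite: Shimura1998, §14.3 Prop. 5, p. 104] -/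
theorem not_exists_principal_fiftySix_plus (hζ : IsPrimitiveRoot ζ 56) (Φ : CMType K)
    (hodd : Odd (((Finset.univ.filter fun t : ZMod 56 => ∃ σ ∈ Φ.1, σ ζ = 𝐞 t) ∩
      ({1, 9, 15, 17, 23, 25, 31, 33, 39, 41, 47, 55} : Finset (ZMod 56)) ∩
      ({1, 5, 11, 15, 19, 25, 29, 33, 39, 43, 47, 53} : Finset (ZMod 56))).card)) :
    ¬ ∃ ζ' : K, IsCMField.complexConj K ζ' = -ζ' ∧ (∀ φ : Φ.1, 0 < (φ.1 ζ').im) ∧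
        CMTypeLattice.IsOfType (1 : (FractionalIdeal (𝓞 K)⁰ K)ˣ) ζ' ⊤ := by
  classical
  obtain ⟨hCp, -, -, -, -, -, -, -, -, -⟩ := classes_fiftySix
  have hS := isCMTypeSet_residueFilter hζ Φ
  refine not_exists_principal_fiftySix_of_odd_on hζ Φ False ?_
  rw [nodd_fiftySix_eq]
  have hset : ((Finset.univ.filter fun t : ZMod 56 => ∃ σ ∈ Φ.1, σ ζ = 𝐞 t).filter fun t => (NR8 t ↔ False)) ∩
      ({1, 5, 11, 15, 19, 25, 29, 33, 39, 43, 47, 53} : Finset (ZMod 56)) =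
      (Finset.univ.filter fun t : ZMod 56 => ∃ σ ∈ Φ.1, σ ζ = 𝐞 t) ∩
      ({1, 9, 15, 17, 23, 25, 31, 33, 39, 41, 47, 55} : Finset (ZMod 56)) ∩
      ({1, 5, 11, 15, 19, 25, 29, 33, 39, 43, 47, 53} : Finset (ZMod 56)) := by
    ext t
    simp only [mem_inter, mem_filter, mem_univ, true_and]
    constructor
    · rintro ⟨⟨htS, hP⟩, htN⟩
      have ht : t.val.Coprime 56 := hS.1 t (by simpa using htS)
      exact ⟨⟨htS, (hCp t ht).mpr hP⟩, htN⟩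
    · rintro ⟨⟨htS, htC⟩, htN⟩
      have ht : t.val.Coprime 56 := hS.1 t (by simpa using htS)
      exact ⟨⟨htS, (hCp t ht).mp htC⟩, htN⟩
  rw [hset]
  exact hodd

open scoped Classical in
/-- **Row `C₋` at `56`**: `|S_Φ ∩ C₋ ∩ N_odd|` ODD (`C₋ = {χ₈(t) = −1} = {3,5,11,13,19,27,29,37,43,45,51,53}`) ⇒ NO
`ι`-compatible principal polarisation on `ℂ^Φ/Φ(ℤ[ζ₅₆])`.
research route conditional on HC_CM; not a corollary; Q11.4-sentence-2 already refuted in dim ≥ 3. [cite: Shimura1998, §14.3 Prop. 5, p. 104] -/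
theorem not_exists_principal_fiftySix_minus (hζ : IsPrimitiveRoot ζ 56) (Φ : CMType K)
    (hodd : Odd (((Finset.univ.filter fun t : ZMod 56 => ∃ σ ∈ Φ.1, σ ζ = 𝐞 t) ∩
      ({3, 5, 11, 13, 19, 27, 29, 37, 43, 45, 51, 53} : Finset (ZMod 56)) ∩
      ({1, 5, 11, 15, 19, 25, 29, 33, 39, 43, 47, 53} : Finset (ZMod 56))).card)) :
    ¬ ∃ ζ' : K, IsCMField.complexConj K ζ' = -ζ' ∧ (∀ φ : Φ.1, 0 < (φ.1 ζ').im) ∧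
        CMTypeLattice.IsOfType (1 : (FractionalIdeal (𝓞 K)⁰ K)ˣ) ζ' ⊤ := by
  classical
  obtain ⟨-, hCm, -, -, -, -, -, -, -, -⟩ := classes_fiftySix
  have hS := isCMTypeSet_residueFilter hζ Φ
  refine not_exists_principal_fiftySix_of_odd_on hζ Φ True ?_
  rw [nodd_fiftySix_eq]
  have hset : ((Finset.univ.filter fun t : ZMod 56 => ∃ σ ∈ Φ.1, σ ζ = 𝐞 t).filter fun t => (NR8 t ↔ True)) ∩
      ({1, 5, 11, 15, 19, 25, 29, 33, 39, 43, 47, 53} : Finset (ZMod 56)) =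
      (Finset.univ.filter fun t : ZMod 56 => ∃ σ ∈ Φ.1, σ ζ = 𝐞 t) ∩
      ({3, 5, 11, 13, 19, 27, 29, 37, 43, 45, 51, 53} : Finset (ZMod 56)) ∩
      ({1, 5, 11, 15, 19, 25, 29, 33, 39, 43, 47, 53} : Finset (ZMod 56)) := by
    ext t
    simp only [mem_inter, mem_filter, mem_univ, true_and]
    constructor
    · rintro ⟨⟨htS, hP⟩, htN⟩
      have ht : t.val.Coprime 56 := hS.1 t (by simpa using htS)
      exact ⟨⟨htS, (hCm t ht).mpr hP⟩, htN⟩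
    · rintro ⟨⟨htS, htC⟩, htN⟩
      have ht : t.val.Coprime 56 := hS.1 t (by simpa using htS)
      exact ⟨⟨htS, (hCm t ht).mp htC⟩, htN⟩
  rw [hset]
  exact hodd

open scoped Classical in
/-- **CENSUS ROWS `(56, ℚ(i))` AND `(56, ℚ(√−2))` — NO, HYPOTHESIS-FREE**: for ANY CM type `Φ` of a cyclotomic CM
field `K ⊇ ℚ(ζ₅₆)`, if `n₊₋(Φ) := |S_Φ ∩ {15, 23, 31, 39, 47, 55}|` is EVEN then `ℂ^Φ/Φ(ℤ[ζ₅₆])` carries NO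
`ι`-compatible principal polarisation (`{15,23,31,39,47,55} = C₊ ∩ N_K` for both `K = ℚ(i)`, `N_K = {t ≡ 3 (4)}`,
and `K = ℚ(√−2)` — on `C₊`, `χ₋₈ = χ₋₄`; `|S_Φ ∩ C₊ ∩ N_odd| ≡ n₊₋(Φ) + 3`).  Census b01.25 (A) «`A_Φ` principal ⟹
`n₊₋(Φ)` odd» at `(56, ℚ(i))`, `(56, ℚ(√−2))`: 452 NO classes each.
research route conditional on HC_CM; not a corollary; Q11.4-sentence-2 already refuted in dim ≥ 3. [cite: Shimura1998, §14.3 Prop. 5, p. 104] -/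
theorem not_exists_principal_fiftySix_of_even (hζ : IsPrimitiveRoot ζ 56) (Φ : CMType K)
    (heven : Even (((Finset.univ.filter fun t : ZMod 56 => ∃ σ ∈ Φ.1, σ ζ = 𝐞 t) ∩
      ({15, 23, 31, 39, 47, 55} : Finset (ZMod 56))).card)) :
    ¬ ∃ ζ' : K, IsCMField.complexConj K ζ' = -ζ' ∧ (∀ φ : Φ.1, 0 < (φ.1 ζ').im) ∧
        CMTypeLattice.IsOfType (1 : (FractionalIdeal (𝓞 K)⁰ K)ˣ) ζ' ⊤ := by
  classical
  obtain ⟨hCp, -, hCsym, hNoddSet, hNK, -, hE, hd, -, -⟩ := classes_fiftySix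
  have hS := isCMTypeSet_residueFilter hζ Φ
  refine not_exists_principal_fiftySix_of_odd_on hζ Φ False ?_
  rw [nodd_fiftySix_eq]
  refine odd_card_filter_inter_of hS hCp hNoddSet hNK hCsym hE ?_
  rw [hd, Nat.odd_add']
  exact ⟨fun _ => heven, fun _ => by decide⟩

open scoped Classical in
/-- **CENSUS ROWS `(56, ℚ(√−7))` AND `(56, ℚ(√−14))` — NO, HYPOTHESIS-FREE**: for ANY CM type `Φ` of a cyclotomic
CM field `K ⊇ ℚ(ζ₅₆)`, if `n₊₋(Φ) := |S_Φ ∩ {17, 31, 33, 41, 47, 55}|` is ODD then `ℂ^Φ/Φ(ℤ[ζ₅₆])` carries NO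
`ι`-compatible principal polarisation (`{17,31,33,41,47,55} = C₊ ∩ N_K` for both `K = ℚ(√−7)`, `N_K = {(t/7) = −1}`,
and `K = ℚ(√−14)` — on `C₊`, `χ₋₁₄·χ₋₇ = χ₈ = 1`; `|S_Φ ∩ C₊ ∩ N_odd| ≡ n₊₋(Φ) + 4`).  Census b01.25 (A) «`A_Φ`
principal ⟹ `n₊₋(Φ)` even» at `(56, ℚ(√−7))`, `(56, ℚ(√−14))`: 472 NO classes each.
research route conditional on HC_CM; not a corollary; Q11.4-sentence-2 already refuted in dim ≥ 3. [cite: Shimura1998, §14.3 Prop. 5, p. 104] -/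
theorem not_exists_principal_fiftySix_of_odd (hζ : IsPrimitiveRoot ζ 56) (Φ : CMType K)
    (hodd : Odd (((Finset.univ.filter fun t : ZMod 56 => ∃ σ ∈ Φ.1, σ ζ = 𝐞 t) ∩
      ({17, 31, 33, 41, 47, 55} : Finset (ZMod 56))).card)) :
    ¬ ∃ ζ' : K, IsCMField.complexConj K ζ' = -ζ' ∧ (∀ φ : Φ.1, 0 < (φ.1 ζ').im) ∧
        CMTypeLattice.IsOfType (1 : (FractionalIdeal (𝓞 K)⁰ K)ˣ) ζ' ⊤ := by
  classical
  obtain ⟨hCp, -, hCsym, hNoddSet, -, hNK, -, -, hE, hd⟩ := classes_fiftySix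
  have hS := isCMTypeSet_residueFilter hζ Φ
  refine not_exists_principal_fiftySix_of_odd_on hζ Φ False ?_
  rw [nodd_fiftySix_eq]
  refine odd_card_filter_inter_of hS hCp hNoddSet hNK hCsym hE ?_
  rw [hd, Nat.odd_add]
  exact ⟨fun _ => by decide, fun _ => hodd⟩

end Level56

end Summit.HodgeConjecture.Ring2WeilCoverage.CyclotomicTwistedLevel56

end
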